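import Summits.CriticalPhenomena.SAWScalingLimit.Theorems.SAWLoopFugacityFlowIsingBoundaryRatioFrameDefs
import Summits.CriticalPhenomena.SAWScalingLimit.Theorems.SAWLoopFugacityFlowIsingBoundaryRatioAnchorWalk
import Literature.Probability.LatticeModels.RandomClusterRegionToAnnulus
import HarnessLib

/-!
# Small tools for the assembly of the FK heart (line `fk-anchor-transfer`)
(crux `SAWLoopFugacityFlow.IsingBoundaryRatio`, stmt-CriticalPhenomena-10650)

* `localAgreement_of_le` — local agreement in a ball persists in a smaller ball;
* `ScaleFrame.LadderRSWb.of_le` — the RSW ladder is antitone in its constant;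
* `rcMeasure_real_openConn_pos_of_walk` — an in-volume walk of `G` makes the connection event of the free
  random-cluster measure of `G.comap val` non-null (`0 < p < 1`: the configuration "exactly the edges of the
  walk open" has positive weight);
* `abs_div_sub_one_lt_of_mul_le` — the final elementary step: two crosswise product bounds with a constant
  `C ≤ 1 + η/2` (`η ≤ 1`) squeeze the double ratio into `(1 - η, 1 + η)`.
Folklore bookkeeping; no new definitions.
-/

noncomputable section

open scoped Classical Topology
open Filter Set Metric SimpleGraph MeasureTheory
open Literature.Probability.LatticeModels Literature.Probability.RandomPlanarGeometry
open Literature.Probability.Percolation (BondConfig openConn openGraph)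
open UpperHalfPlane (upperHalfPlaneSet)

namespace Summit.CriticalPhenomena.SAWScalingLimit.Theorems.IsingBoundaryRatio

/-- Local agreement in `B(p, ε)` implies local agreement in every smaller ball `B(p, ε')`, `ε' ≤ ε`
(fewer sites are constrained). [folklore] -/
theorem localAgreement_of_le {Ω : Set ℂ} {p : ℂ} {ε ε' δ : ℝ} {G : SimpleGraph (Site 2)}
    {Λ : Finset (Site 2)} (h : LocalAgreement Ω p ε δ G Λ) (hε : ε' ≤ ε) :
    LocalAgreement Ω p ε' δ G Λ :=
  fun w hw hball v => h w hw (Metric.ball_subset_ball hε hball) v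

/-- **The RSW ladder is antitone in its constant**: lowering `c` weakens all three bounds. [folklore] -/
theorem ladderRSWb_of_le : ∀ {V : Type*} [Fintype V] [DecidableEq V] (F : ScaleFrame V)
    {p q c c' a M : ℝ} {n b : ℕ}, F.LadderRSWb p q c a M n b → c' ≤ c → F.LadderRSWb p q c' a M n b := by
  intro V _ _ F p q c c' a M n b h hc i j hij hj hb
  obtain ⟨h1, h2, h3⟩ := h i j hij hj hb
  refine ⟨hc.trans h1, h2.trans (by linarith), hc.trans h3⟩

/-- **An in-volume walk makes the connection non-null.** For `0 < p < 1`, `0 < q`, a finite volume `Λ`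
of a graph `G` on `Site 2` and a walk of `G` from `u` to `v` with support in `Λ`, the free random-cluster
measure of `G.comap val` on `↥Λ` gives `{u ↔ v}` positive probability: the configuration consisting of
exactly the edges of the (lifted) walk has positive weight and lies in the event. [folklore] -/
theorem rcMeasure_real_openConn_pos_of_walk {G : SimpleGraph (Site 2)} {Λ : Finset (Site 2)}
    {p q : ℝ} (hp0 : 0 < p) (hp1 : p < 1) (hq : 0 < q) {u v : Site 2} (hu : u ∈ Λ) (hv : v ∈ Λ)
    (hw : ∃ w : G.Walk u v, ∀ z ∈ w.support, z ∈ Λ) :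
    0 < (rcMeasure (G.comap (Subtype.val : ↥Λ → Site 2)) p q ∅).real
      (openConn (⟨u, hu⟩ : ↥Λ) ⟨v, hv⟩) := by
  classical
  set H : SimpleGraph ↥Λ := G.comap (Subtype.val : ↥Λ → Site 2) with hH
  -- lift the walk to `H`
  have lift : ∀ {a b : Site 2} (w : G.Walk a b) (ha : a ∈ Λ) (hb : b ∈ Λ),
      (∀ z ∈ w.support, z ∈ Λ) → ∃ w' : H.Walk ⟨a, ha⟩ ⟨b, hb⟩, True := by
    intro a b w
    induction w with
    | nil => intro ha _ _; exact ⟨Walk.nil, trivial⟩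
    | @cons a c b hac q ih =>
      intro ha hb hs
      have hc : c ∈ Λ := hs c (by rw [Walk.support_cons]; exact List.mem_cons_of_mem _ q.start_mem_support)
      obtain ⟨w', -⟩ := ih hc hb (fun z hz => hs z (by rw [Walk.support_cons]; exact List.mem_cons_of_mem _ hz))
      exact ⟨Walk.cons (show H.Adj ⟨a, ha⟩ ⟨c, hc⟩ from hac) w', trivial⟩
  obtain ⟨w, hws⟩ := hw
  obtain ⟨w', -⟩ := lift w hu hv hws
  -- the configuration "exactly the edges of the walk"
  set ω₀ : Finset (Sym2 ↥Λ) := w'.edges.toFinset with hω₀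
  have hω₀E : ω₀ ⊆ H.edgeFinset := by
    intro e he
    rw [hω₀, List.mem_toFinset] at he
    exact SimpleGraph.mem_edgeFinset.2 (w'.edges_subset_edgeSet he)
  have hp : p ∈ Set.Icc (0 : ℝ) 1 := ⟨hp0.le, hp1.le⟩
  refine rcMeasure_real_pos_of_rcWeight_pos H hp hq ∅ hω₀E ?_ ?_
  · -- the walk is open in `↑ω₀`
    show (openGraph (↑ω₀ : BondConfig ↥Λ)).Reachable ⟨u, hu⟩ ⟨v, hv⟩
    have hle : H ⊓ (fromEdgeSet (↑ω₀ : Set (Sym2 ↥Λ))) ≤ openGraph (↑ω₀ : BondConfig ↥Λ) := by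
      intro a b hab
      exact hab.2
    have hw'' : ∀ e ∈ w'.edges, e ∈ (fromEdgeSet (↑ω₀ : Set (Sym2 ↥Λ))).edgeSet := by
      intro e he
      rw [edgeSet_fromEdgeSet]
      refine ⟨?_, w'.edges_subset_edgeSet he |> H.not_isDiag_of_mem_edgeSet⟩
      rw [Finset.mem_coe, hω₀, List.mem_toFinset]; exact he
    -- transfer the walk to the open graph edge by edge
    have key : ∀ {a b : ↥Λ} (π : H.Walk a b), (∀ e ∈ π.edges, e ∈ (fromEdgeSet (↑ω₀ : Set (Sym2 ↥Λ))).edgeSet) →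
        (openGraph (↑ω₀ : BondConfig ↥Λ)).Reachable a b := by
      intro a b π
      induction π with
      | nil => intro; exact Reachable.refl _
      | @cons a c b hac r ih =>
        intro he
        have h1 : s(a, c) ∈ (fromEdgeSet (↑ω₀ : Set (Sym2 ↥Λ))).edgeSet :=
          he _ (by rw [Walk.edges_cons]; exact List.mem_cons_self)
        have hadj : (openGraph (↑ω₀ : BondConfig ↥Λ)).Adj a c := by
          rw [Literature.Probability.Percolation.openGraph_adj]
          rw [edgeSet_fromEdgeSet] at h1
          exact ⟨h1.1, hac.ne⟩
        exact hadj.reachable.trans (ih fun e he' => he e (by rw [Walk.edges_cons]; exact List.mem_cons_of_mem _ he'))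
    exact key w' hw''
  · -- positive weight
    unfold rcWeight
    have h1 : 0 < 1 - p := by linarith
    positivity

/-- **The last elementary step.** If `N₁ M₂ ≤ C (M₁ N₂)` and `N₂ M₁ ≤ C (M₂ N₁)` with all four positive,
`C ≤ 1 + η/2` and `0 < η ≤ 1`, then `|(N₁/M₁)/(N₂/M₂) - 1| < η`. [folklore] -/
theorem abs_div_sub_one_lt_of_mul_le {N₁ M₁ N₂ M₂ C η : ℝ} (hN₁ : 0 < N₁) (hM₁ : 0 < M₁)
    (hN₂ : 0 < N₂) (hM₂ : 0 < M₂) (h12 : N₁ * M₂ ≤ C * (M₁ * N₂)) (h21 : N₂ * M₁ ≤ C * (M₂ * N₁))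
    (hC : C ≤ 1 + η / 2) (hη : 0 < η) (hη1 : η ≤ 1) :
    |N₁ / M₁ / (N₂ / M₂) - 1| < η := by
  have hpos : 0 < M₁ * N₂ := mul_pos hM₁ hN₂
  have hdr : N₁ / M₁ / (N₂ / M₂) = (N₁ * M₂) / (M₁ * N₂) := by
    field_simp
  have hC0 : 0 < C := by
    by_contra h
    push Not at h
    have : N₁ * M₂ ≤ 0 := h12.trans (mul_nonpos_of_nonpos_of_nonneg h hpos.le)
    nlinarith [mul_pos hN₁ hM₂]
  set t : ℝ := N₁ * M₂ / (M₁ * N₂) with ht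
  have ht_le : t ≤ C := by rw [ht, div_le_iff₀ hpos]; exact h12
  have ht_ge : 1 ≤ C * t := by
    rw [ht, ← mul_div_assoc, le_div_iff₀ hpos, one_mul]
    nlinarith [h21]
  rw [hdr, abs_sub_lt_iff]
  constructor
  · linarith
  · -- `t ≥ 1/C ≥ 1/(1 + η/2) > 1 - η`
    have h3 : (1 - η) * C < 1 := by nlinarith
    nlinarith [ht_ge, h3, hC0]

end Summit.CriticalPhenomena.SAWScalingLimit.Theorems.IsingBoundaryRatio

end
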